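import Summits.BirchSwinnertonDyer.BirchSwinnertonDyer.Theorems.ClassRecordThreeEulerHalvesAtThreeCartanSupplyCubicDescentOps
import HarnessLib

/-!
# Eisenstein descent on `V₁`, II: `V₁ ≈ L ⊕ RL` up to index `3q`, and `tr(g | L) = χ_W(g)`

Helper file `--supports stmt-BirchSwinnertonDyer-23422` (seat `bsd-stepL-tam3-p1` g23, LINE OWNER of crux 23422, line `cartan` v11), serving the registered
stub (SUPPLY) `stub_cartanTorusLatticeSupply` (memo `HOME/tam3-p1/g23/SUPPLY-ROAD-GG1.md` §2), continuing `…CubicDescentOps`. With `d(v) = qv − S₀v`,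
`W(v) = R²d − Rd` (`= −θd`) and `U(v) = 3qv − RW(v)` (`opD`, `opW`, `opU`), the operator algebra of Part I (`S₀² = q²`, `S₀θ = −θS₀`, `S₀R = R²S₀`,
`θ² = −3`, `1 + R + R² = 0` on `V₁`) gives `S₀W(v) = qW(v)` and `S₀U(v) = qU(v)` for `v ∈ V₁` (`S0_opW`, `S0_opU`), i.e. `U(v), W(v) ∈ L`; so
`Φ : L × L → V₁, (u, w) ↦ u + Rw` (`PhiL`) and `Ψ : V₁ → L × L, v ↦ (U v, W v)` (`PsiL`) satisfy **`ΦΨ = 3q`, `ΨΦ = 3q`** (`PhiL_comp_PsiL`,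
`PsiL_comp_PhiL`) and intertwine the `G`-actions, whence by the finite-index trace comparison of `…CubicV1` and `tr(g | V₁) = 2χ_W(g)`:
**`trace_actL`** : `tr(g | L) = χ_W(g)` for all `g ∈ GL₂(𝔽_q)`, `q ≡ 1 (mod 3)`, `χ_W = cubicNewvectorChar q` BY NAME — the `trace_eq` field of a
`CartanTorusLattice q` for the integral lattice `L ⊂ ℤ[X]` of rank `q + 1`, with NO character theory and NO `⊗ℚ`.
HONEST FRAMING: linear algebra over `ℤ`; nothing about SUPPLY (form, mod-3, torus lines remain), NUM, crux 23422 ∕ 19109 is proved here; BSD is proved for no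
curve. [folklore]
-/

namespace Summit.BirchSwinnertonDyer.BirchSwinnertonDyer.Theorems.CartanSupply.CubicDescent

open Summit.BirchSwinnertonDyer.BirchSwinnertonDyer.Theorems.CartanDegree
open Summit.BirchSwinnertonDyer.BirchSwinnertonDyer.Theorems.CartanTorusCubeCut
open Summit.BirchSwinnertonDyer.BirchSwinnertonDyer.Theorems.CartanSupply.CubicClasses
open Summit.BirchSwinnertonDyer.BirchSwinnertonDyer.Theorems.CartanSupply.CubicHecke
open Summit.BirchSwinnertonDyer.BirchSwinnertonDyer.Theorems.CartanSupply.CubicFibres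
open Summit.BirchSwinnertonDyer.BirchSwinnertonDyer.Theorems.CartanSupply.CubicV1

set_option linter.dupNamespace false
set_option autoImplicit false

open scoped Classical

variable {q : ℕ} [Fact q.Prime]

/-! ## §1 The operators `d`, `W`, `U` -/

/-- `d(v) = q v − S₀ v`. -/
noncomputable def opD (h1 : q % 3 = 1) : (X q → ℤ) →ₗ[ℤ] (X q → ℤ) := (q : ℤ) • LinearMap.id - S0 h1

/-- `W(v) = R²d(v) − Rd(v)`. -/
noncomputable def opW (h1 : q % 3 = 1) : (X q → ℤ) →ₗ[ℤ] (X q → ℤ) := (R h1 ∘ₗ R h1 - R h1) ∘ₗ opD h1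

/-- `U(v) = 3q v − RW(v)`. -/
noncomputable def opU (h1 : q % 3 = 1) : (X q → ℤ) →ₗ[ℤ] (X q → ℤ) := (3 * (q : ℤ)) • LinearMap.id - R h1 ∘ₗ opW h1

/-- PROVED: unfolding. [folklore] -/
theorem opD_apply (h1 : q % 3 = 1) (φ : X q → ℤ) : opD h1 φ = (q : ℤ) • φ - S0 h1 φ := rfl

/-- PROVED: unfolding. [folklore] -/
theorem opW_apply (h1 : q % 3 = 1) (φ : X q → ℤ) : opW h1 φ = R h1 (R h1 (opD h1 φ)) - R h1 (opD h1 φ) := rfl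

/-- PROVED: unfolding. [folklore] -/
theorem opU_apply (h1 : q % 3 = 1) (φ : X q → ℤ) : opU h1 φ = (3 * (q : ℤ)) • φ - R h1 (opW h1 φ) := rfl

/-- PROVED: `d(V₁) ⊂ V₁`. [folklore] -/
theorem opD_mem (h1 : q % 3 = 1) {φ : X q → ℤ} (hφ : φ ∈ V1 q) : opD h1 φ ∈ V1 q := by
  rw [opD_apply]; exact (V1 q).sub_mem ((V1 q).smul_mem _ hφ) (S0_mem_V1 h1 hφ)

/-- PROVED: `W(V₁) ⊂ V₁`. [folklore] -/
theorem opW_mem (h1 : q % 3 = 1) {φ : X q → ℤ} (hφ : φ ∈ V1 q) : opW h1 φ ∈ V1 q := by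
  rw [opW_apply]
  exact (V1 q).sub_mem (R_mem_V1 h1 (R_mem_V1 h1 (opD_mem h1 hφ))) (R_mem_V1 h1 (opD_mem h1 hφ))

/-- PROVED: `U(V₁) ⊂ V₁`. [folklore] -/
theorem opU_mem (h1 : q % 3 = 1) {φ : X q → ℤ} (hφ : φ ∈ V1 q) : opU h1 φ ∈ V1 q := by
  rw [opU_apply]; exact (V1 q).sub_mem ((V1 q).smul_mem _ hφ) (R_mem_V1 h1 (opW_mem h1 hφ))

/-- PROVED: `S₀ d(v) = −q d(v)` on `V₁`. [folklore] -/
theorem S0_opD (h1 : q % 3 = 1) {φ : X q → ℤ} (hφ : φ ∈ V1 q) : S0 h1 (opD h1 φ) = -((q : ℤ) • opD h1 φ) := by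
  rw [opD_apply, map_sub, map_smul, S0_S0 h1 hφ, smul_sub, smul_smul]
  abel

/-- PROVED — **`S₀ W(v) = q W(v)`** on `V₁` (so `W(v) ∈ L`). [folklore] -/
theorem S0_opW (h1 : q % 3 = 1) {φ : X q → ℤ} (hφ : φ ∈ V1 q) : S0 h1 (opW h1 φ) = (q : ℤ) • opW h1 φ := by
  rw [opW_apply, map_sub, S0_R, S0_R, R_R_R, S0_opD h1 hφ]
  simp only [map_neg, map_smul]
  module

/-- PROVED: `R²W − RW = −3d` on `V₁`. [folklore] -/
theorem RR_opW_sub (h1 : q % 3 = 1) {φ : X q → ℤ} (hφ : φ ∈ V1 q) :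
    R h1 (R h1 (opW h1 φ)) - R h1 (opW h1 φ) = (-3 : ℤ) • opD h1 φ := by
  have hrel := one_R_R2 h1 (opD_mem h1 hφ)
  rw [opW_apply]
  simp only [map_sub, R_R_R]
  have hR2 : R h1 (R h1 (opD h1 φ)) = -opD h1 φ - R h1 (opD h1 φ) := by
    rw [eq_sub_iff_add_eq, eq_neg_iff_add_eq_zero, ← hrel]; abel
  rw [hR2]
  module

/-- PROVED — **`S₀ U(v) = q U(v)`** on `V₁` (so `U(v) ∈ L`). [folklore] -/
theorem S0_opU (h1 : q % 3 = 1) {φ : X q → ℤ} (hφ : φ ∈ V1 q) : S0 h1 (opU h1 φ) = (q : ℤ) • opU h1 φ := by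
  have hW := S0_opW h1 hφ
  have hRR := RR_opW_sub h1 hφ
  rw [opU_apply, map_sub, map_smul, S0_R, hW, map_smul, map_smul, smul_sub]
  -- `3q S₀φ − q R²W = 3q·qφ − q RW` ⟺ `3q(S₀φ − qφ) = q(R²W − RW) = −3q d`
  have hd : S0 h1 φ = (q : ℤ) • φ - opD h1 φ := by rw [opD_apply]; abel
  rw [hd]
  have hR2W : R h1 (R h1 (opW h1 φ)) = R h1 (opW h1 φ) + (-3 : ℤ) • opD h1 φ := by rw [← hRR]; abel
  rw [hR2W]
  module

/-- PROVED: `W(v) ∈ L` for `v ∈ V₁`. [folklore] -/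
theorem opW_mem_latL (h1 : q % 3 = 1) {φ : X q → ℤ} (hφ : φ ∈ V1 q) : opW h1 φ ∈ latL h1 :=
  (mem_latL_iff h1 _).mpr ⟨opW_mem h1 hφ, S0_opW h1 hφ⟩

/-- PROVED: `U(v) ∈ L` for `v ∈ V₁`. [folklore] -/
theorem opU_mem_latL (h1 : q % 3 = 1) {φ : X q → ℤ} (hφ : φ ∈ V1 q) : opU h1 φ ∈ latL h1 :=
  (mem_latL_iff h1 _).mpr ⟨opU_mem h1 hφ, S0_opU h1 hφ⟩

/-! ## §2 The comparison maps `Φ : L × L → V₁`, `Ψ : V₁ → L × L` -/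

/-- PROVED: `L ≤ V₁`. [folklore] -/
theorem latL_le_V1 (h1 : q % 3 = 1) : latL h1 ≤ V1 q := inf_le_left

/-- `Φ(u, w) = u + Rw`. -/
noncomputable def PhiL (h1 : q % 3 = 1) : (latL h1 × latL h1) →ₗ[ℤ] V1 q :=
  LinearMap.codRestrict (V1 q) ((latL h1).subtype.coprod (R h1 ∘ₗ (latL h1).subtype)) (fun uw => by
    rw [LinearMap.coprod_apply, Submodule.subtype_apply, LinearMap.comp_apply, Submodule.subtype_apply]
    exact (V1 q).add_mem (latL_le_V1 h1 uw.1.2) (R_mem_V1 h1 (latL_le_V1 h1 uw.2.2)))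

/-- PROVED: unfolding. [folklore] -/
theorem PhiL_apply (h1 : q % 3 = 1) (u w : latL h1) : ((PhiL h1 (u, w) : V1 q) : X q → ℤ) = (u : X q → ℤ) + R h1 (w : X q → ℤ) := rfl

/-- `Ψ(v) = (U v, W v)`. -/
noncomputable def PsiL (h1 : q % 3 = 1) : V1 q →ₗ[ℤ] (latL h1 × latL h1) :=
  LinearMap.prod
    (LinearMap.codRestrict (latL h1) (opU h1 ∘ₗ (V1 q).subtype) (fun v => opU_mem_latL h1 v.2))
    (LinearMap.codRestrict (latL h1) (opW h1 ∘ₗ (V1 q).subtype) (fun v => opW_mem_latL h1 v.2))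

/-- PROVED: first component of `Ψ`. [folklore] -/
theorem PsiL_fst (h1 : q % 3 = 1) (v : V1 q) : ((PsiL h1 v).1 : X q → ℤ) = opU h1 (v : X q → ℤ) := rfl

/-- PROVED: second component of `Ψ`. [folklore] -/
theorem PsiL_snd (h1 : q % 3 = 1) (v : V1 q) : ((PsiL h1 v).2 : X q → ℤ) = opW h1 (v : X q → ℤ) := rfl

/-- PROVED — **`Φ Ψ = 3q`**. [folklore] -/
theorem PhiL_comp_PsiL (h1 : q % 3 = 1) : PhiL h1 ∘ₗ PsiL h1 = (3 * (q : ℤ)) • (LinearMap.id : V1 q →ₗ[ℤ] V1 q) := by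
  refine LinearMap.ext fun v => Subtype.ext ?_
  rw [LinearMap.comp_apply, show PsiL h1 v = ((PsiL h1 v).1, (PsiL h1 v).2) from rfl, PhiL_apply, PsiL_fst, PsiL_snd, opU_apply,
    sub_add_cancel, LinearMap.smul_apply, LinearMap.id_apply, Submodule.coe_smul]

/-- PROVED — **`Ψ Φ = 3q`**. [folklore] -/
theorem PsiL_comp_PhiL (h1 : q % 3 = 1) :
    PsiL h1 ∘ₗ PhiL h1 = (3 * (q : ℤ)) • (LinearMap.id : (latL h1 × latL h1) →ₗ[ℤ] (latL h1 × latL h1)) := by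
  refine LinearMap.ext fun uw => ?_
  obtain ⟨u, w⟩ := uw
  obtain ⟨huV, huS⟩ := (mem_latL_iff h1 _).mp u.2
  obtain ⟨hwV, hwS⟩ := (mem_latL_iff h1 _).mp w.2
  have hrel := one_R_R2 h1 hwV
  -- `d(u + Rw) = q(Rw − R²w)`
  have hD : opD h1 ((u : X q → ℤ) + R h1 (w : X q → ℤ)) = (q : ℤ) • (R h1 (w : X q → ℤ) - R h1 (R h1 (w : X q → ℤ))) := by
    rw [opD_apply, map_add, S0_R, huS, hwS, map_smul, map_smul]
    module
  -- `W(u + Rw) = 3q w`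
  have hW : opW h1 ((u : X q → ℤ) + R h1 (w : X q → ℤ)) = (3 * (q : ℤ)) • (w : X q → ℤ) := by
    rw [opW_apply, hD]
    simp only [map_smul, map_sub, R_R_R]
    have hR2 : R h1 (R h1 (w : X q → ℤ)) = -(w : X q → ℤ) - R h1 (w : X q → ℤ) := by
      rw [eq_sub_iff_add_eq, eq_neg_iff_add_eq_zero, ← hrel]; abel
    rw [hR2]
    module
  -- `U(u + Rw) = 3q u`
  have hU : opU h1 ((u : X q → ℤ) + R h1 (w : X q → ℤ)) = (3 * (q : ℤ)) • (u : X q → ℤ) := by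
    rw [opU_apply, hW, map_smul, smul_add, add_sub_cancel_right]
  rw [LinearMap.comp_apply, LinearMap.smul_apply, LinearMap.id_apply]
  apply Prod.ext
  · apply Subtype.ext
    rw [PsiL_fst, PhiL_apply, hU, Prod.smul_fst, Submodule.coe_smul]
  · apply Subtype.ext
    rw [PsiL_snd, PhiL_apply, hW, Prod.smul_snd, Submodule.coe_smul]

/-! ## §3 Equivariance and the trace -/

/-- PROVED: the action commutes with `d`. [folklore] -/
theorem act_opD (h1 : q % 3 = 1) (g : G q) (φ : X q → ℤ) : act ℤ g (opD h1 φ) = opD h1 (act ℤ g φ) := by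
  rw [opD_apply, opD_apply, map_sub, map_smul, act_S0]

/-- PROVED: the action commutes with `W`. [folklore] -/
theorem act_opW (h1 : q % 3 = 1) (g : G q) (φ : X q → ℤ) : act ℤ g (opW h1 φ) = opW h1 (act ℤ g φ) := by
  simp only [opW_apply, map_sub, act_R, act_opD]

/-- PROVED: the action commutes with `U`. [folklore] -/
theorem act_opU (h1 : q % 3 = 1) (g : G q) (φ : X q → ℤ) : act ℤ g (opU h1 φ) = opU h1 (act ℤ g φ) := by
  rw [opU_apply, opU_apply, map_sub, map_smul, act_R, act_opW]

/-- PROVED: `Φ` intertwines the actions. [folklore] -/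
theorem actV1_comp_PhiL (h1 : q % 3 = 1) (g : G q) :
    actV1 g ∘ₗ PhiL h1 = PhiL h1 ∘ₗ ((actL h1 g).prodMap (actL h1 g) : _ →ₗ[ℤ] (latL h1 × latL h1)) := by
  refine LinearMap.ext fun uw => Subtype.ext ?_
  obtain ⟨u, w⟩ := uw
  rw [LinearMap.comp_apply, LinearMap.comp_apply, LinearMap.prodMap_apply, PhiL_apply]
  show act ℤ g ((PhiL h1 (u, w) : V1 q) : X q → ℤ) = (actL h1 g u : X q → ℤ) + R h1 (actL h1 g w : X q → ℤ)
  rw [PhiL_apply, map_add, act_R]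
  rfl

/-- PROVED — **`tr(g | V₁) = 2·tr(g | L)`**. [folklore] -/
theorem trace_actV1_eq_two_mul (h1 : q % 3 = 1) (g : G q) :
    LinearMap.trace ℤ (V1 q) (actV1 g) = 2 * LinearMap.trace ℤ (latL h1) (actL h1 g) := by
  have hq0 : (3 * (q : ℤ)) ≠ 0 := by
    have : 0 < q := (Fact.out : q.Prime).pos
    positivity
  rw [trace_eq_of_intertwine (PhiL h1) (PsiL h1) (3 * (q : ℤ)) hq0 (PhiL_comp_PsiL h1) (PsiL_comp_PhiL h1) (actV1 g)
    ((actL h1 g).prodMap (actL h1 g)) (actV1_comp_PhiL h1 g), LinearMap.trace_prodMap', two_mul]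

/-- PROVED — **`tr(g | L) = χ_W(g)`** for every `g ∈ GL₂(𝔽_q)`, `q ≡ 1 (mod 3)`: the descended lattice `L ⊂ ℤ[X]` has character
`cubicNewvectorChar q` BY NAME. [folklore] -/
theorem trace_actL (h1 : q % 3 = 1) (g : G q) : LinearMap.trace ℤ (latL h1) (actL h1 g) = cubicNewvectorChar q g := by
  have h := trace_actV1 h1 g
  rw [trace_actV1_eq_two_mul h1 g] at h
  linarith

end Summit.BirchSwinnertonDyer.BirchSwinnertonDyer.Theorems.CartanSupply.CubicDescent
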